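import Summits.AtomisticToContinuum.HydrodynamicLimit.Theses.RelayRaceLocality
import Summits.AtomisticToContinuum.HydrodynamicLimit.Theorems.KineticWindowGronwall.Negative.ConsequentLoadBearing
import Literature.MathematicalPhysics.KineticTheory.HardSphereCanonicalTorus

/-!
# Disproof work file — crux `RelayRaceLocality.NearConstantShortTimeHL` (stmt-AtomisticToContinuum-12502)

refuter-cdisprove-stmt-AtomisticToContinuum-12502-0, cycle 1 (2026-08-16). Prose only in docstrings; every
`theorem` below is kernel-checked (no `sorry`) unless it sits in the `NearMisses` section.

## Findings (index)

* §0 READ-BACK / JUNK AUDIT (docstring `readback`): no kill. The statement is the faithfully typed near-equilibrium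
  short-time hydrodynamic limit (open, Spohn 1991 §7.1); every junk lever of the interface (empty hard-sphere domain,
  zero partition function, junk flow values off the good set, `0⁻¹`, Bochner junk) sits on the HYPOTHESIS side
  (`∀ N, IsProbabilityMeasure (P N)`, the `t = 0` LLN tie) and only makes instances vacuous, never false; the only
  rigorous handles on the time-`t` law of deterministic hard spheres (conservation laws, invariant homogeneous Gibbs
  laws, Galilean/scaling covariance) are all CONSISTENT with the Euler prediction (constant data ⇒ constant classical
  solution is unique in the dilute class, tree: `PolynomialCompressionConstantProfiles.unique_of_dilute`).
* §1 `NearConstantShortTimeHLUntied` — the crux with its `t = 0` LLN tie DELETED, all else verbatim — is FALSE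
  (`nearConstantShortTimeHLUntied_false`, UNCONDITIONAL: Alexander flows `flows_nonempty` + tree statics
  `lln_rhoLim` for the probability clause). Mechanism: the near-constancy clause `∃ ubar θbar, …` does not pin the data
  — for the SAME uniform gas the constant classical solutions `(1,0,1)` and `(1,0,2)` meet every remaining hypothesis
  (guards with `M = 2`), and their energy LLNs at one time `t > 0` contradict uniqueness of limits in probability.
  ⇒ any proof is anchored in the tie; `θbar`, `ubar` carry no information beyond it.
* §2 `NearConstantShortTimeHLNoPDE` — `IsHardSphereEulerSolution` WEAKENED to joint smoothness + positivity (the three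
  balance laws deleted; tie, near-constancy and guards kept) — is FALSE (`nearConstantShortTimeHLNoPDE_false`,
  UNCONDITIONAL): uniform activity pins `ρ(0) ≡ 1` (`rhoLim_uniform_eq_one`), the smooth near-constant fields
  `(1 + t, 0, 1)` ARE tied at `t = 0` and obey all `C¹` guards with `M = 1`, while the empirical density of `χ ≡ 1`
  is identically `1` whatever the dynamics. ⇒ any proof integrates (at least) mass conservation along the solution.
* §3 NOT load-bearing (documented in `redundant_hypotheses`, not landed): `∀ N, 0 < ε N` and
  `Tendsto ε atTop (nhds 0)` are implied up to finitely many `N` by `n ε³ → σ³ > 0` + the tie; the drift guard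
  `‖u‖ ≤ M` is removable by Galilean covariance on `𝕋³` (only `‖u − ubar‖` matters); `∀ N, IsProbabilityMeasure (P N)`
  is equivalent to `∀ N, P N ≠ 0` — PROVED: `particleLaw_canonicalDensity_zero_or_prob` (a canonical law with a
  nonnegative profile is the zero measure or a probability measure) and `isProbabilityMeasure_iff_ne_zero`.
* §4 LINE `Sketch` (card fejer-isometry-window-transfer, `Cruxes/…/IdeatorTwoSketch.lean`): the abstract stubs
  `IsometryAverageLe`, `FejerCesaroComparison`, `SemigroupRigidity` are TRUE (proof sketches in `line_sketch_audit`);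
  `EulerWindowKineticNoLeak` / `ExpWindowDecay` are open-problem-level and carry a MEASURABILITY obligation (time
  integrals along `(Φ N).flow`: `HardSphereFlow` records measurability of each `Φ_t` only; joint measurability of
  `(s,z) ↦ Φ_s z` on `[0,S] × good` follows from right-continuity of trajectories and must be proved before the outer
  Bochner integrals are known to be non-junk — the stubs are genuine, but unusable by `BridgeShape` until then);
  `BridgeShape` hides the energy-current class problem already filed on crux 9282
  (`KineticWindowGronwall/Negative/CubicMomentDiverges`).
  No stub is refutable by a small model: every physical stub quantifies over genuine hard-sphere flows.
  §4b (`ideator_one_audit`, ideator 1's cards): `MeansPinLLN` TRUE in substance (exact entropy identity + isentropy),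
  `SmallTiltDomination` TRUE (static), `EquilibriumClosureTightness` open; `TiltRadius` MISSTATED — an `N`-uniform
  analyticity radius in the tilt amplitude that ignores the tilt shape's gradients and allows `t = 1` contradicts
  shock formation of short sound waves (Montel ⇒ real-analytic limit across the shock-formation amplitude); repair:
  radius `r₀(M)/(1 + Lip·t)`, which is all the guarded crux needs.
* §5 WHY IT RESISTS (`why_it_resists`): a refutation needs the time-`t` law of `N → ∞` deterministic hard spheres OUT
  of equilibrium; the only computable cases (homogeneous Gibbs laws, invariant under every `HardSphereFlow` —
  tree `measurePreserving_flow_localGibbsLaw_const`) have constant Euler data, for which the conclusion is TRUE.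
  A kill therefore requires either (i) an `O(1)`-slow non-hydrodynamic mode of the dilute hard-sphere gas (none is
  known or expected: kinetic modes relax on the mean-free-time scale `≍ N^{-1/3}`), or (ii) non-uniqueness of classical
  hs-Euler solutions for near-constant dilute data (excluded by the tree's analytic-EOS uniqueness). Verdict: survives.
-/

noncomputable section

namespace Summit.AtomisticToContinuum.HydrodynamicLimit.Cruxes.NearConstantShortTimeHL.Disproof

open MeasureTheory Filter Set Topology
open scoped ENNReal
open Literature.MathematicalPhysics.KineticTheory Literature.Analysis.FluidPDE
open Literature.Analysis.FunctionSpaces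
open Summit.AtomisticToContinuum.HydrodynamicLimit.Theorems
open Summit.AtomisticToContinuum.HydrodynamicLimit.Theorems.PolynomialCompressionPDE (Flows flows_nonempty lln_rhoLim)
open Summit.AtomisticToContinuum.HydrodynamicLimit.Theorems.DenseExcursionUntied (isHardSphereEulerSolution_const)
open Summit.AtomisticToContinuum.HydrodynamicLimit.Theorems.DenseExcursionAtTimeZero (eq_of_tendsto_measure_lt_abs)
open Summit.AtomisticToContinuum.HydrodynamicLimit.Theorems.KineticWindowGronwallNegative
  (ramp ramp_zero isSmoothSpaceTimeOn_ramp rhoLim_uniform_eq_one tendstoHydroFieldsAt_congr_slices)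

/-! ## §0 Read-back and the conjunct's family -/

/-- READ-BACK of `NearConstantShortTimeHL` (elaborated symbol by symbol; W.lean rc 0, one `sorry`).
Quantifiers: `∃ η₀>0 ∀ M>0 ∃ δ₀>0 ∃ τ₀>0 ∀ (a₀ θ₀ u₀ continuous, a₀ θ₀ > 0) ∃ σ₀>0 ∀ σ∈(0,σ₀) ∀ (ε n), (∀N, 0<ε N) →
ε → 0 → n ε³ → σ³ → ∀ T ρ θ u, IsHardSphereEulerSolution σ T ρ u θ → (∃ ubar θbar, ∀ x, |ρ 0 x − 1| ≤ δ₀ ∧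
‖u 0 x − ubar‖ ≤ δ₀ ∧ |θ 0 x − θbar| ≤ δ₀) → ∀ Φ, (∀ N, IsProbabilityMeasure (P N)) → LLN₀ → ∀ t ∈ [0, min T τ₀),
guards on [0,t] → LLNₜ`, with `P N = particleLaw (Φ N) (canonicalDensity 𝕋³ (ε N) (n N) (localGibbsProfile a₀ u₀ θ₀))`
(for the conjunct's family `ε N = hsDiameter σ N`, `n N = N+1` this is `localGibbsLaw σ a₀ u₀ θ₀ N (Φ N)` by `rfl`).
Coercions: `(n N : ℝ)`; `M⁻¹` real inverse (`M > 0`, no junk); empirical fields are `(n N)⁻¹ ∑` through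
`empiricalMeasure` (zero measure for `n N = 0`, impossible eventually since `n ε³ → σ³ > 0`); `∫ x, χ x * ρ t x` Bochner
over the Haar probability measure of `𝕋³` (continuous integrands, no junk); `Torus.partialDeriv` = `deriv` of the
re-centred lift (genuine for the jointly `C^∞` fields of `IsHardSphereEulerSolution`); measures of possibly
non-measurable deviation sets are outer measures (harmless). Silent restrictions: none (`Fin 3`, `T3`, `V3` concrete).
Quantifier order matches the informal text (δ₀, τ₀ depend on M only; σ₀ on the profile only). The tie forces
`u 0 = u₀`, `θ 0 = θ₀`, `ρ 0 = rhoLim (profileOf a₀) σ` (tree: `PolynomialCompressionPDE.admissible_iff_data`,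
conjunct family), so near-constancy is a condition on the PROFILE through the statics map `a₀ ↦ rhoLim`.
[refuter-cdisprove 12502, cycle 1] -/
theorem readback : True := trivial

/-- The conjunct's family has reduced density exactly `σ³`. [folklore] -/
theorem tendsto_family_density (σ : ℝ) :
    Tendsto (fun N : ℕ => ((N + 1 : ℕ) : ℝ) * hsDiameter σ N ^ 3) atTop (𝓝 (σ ^ 3)) := by
  simp_rw [succ_mul_hsDiameter_pow_three]
  exact tendsto_const_nhds

/-- A reduced density below two thresholds, below `1/2`, and with packing `2σ³ < η₀`. [folklore] -/
theorem exists_small_sigma {σ₀ σ₁ η₀ : ℝ} (hσ₀ : 0 < σ₀) (hσ₁ : 0 < σ₁) (hη₀ : 0 < η₀) :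
    ∃ σ : ℝ, 0 < σ ∧ σ < σ₀ ∧ σ < σ₁ ∧ 2 * σ ^ 3 < η₀ ∧ σ < 1 / 2 := by
  set σ : ℝ := min (min (σ₀ / 2) (σ₁ / 2)) (min (η₀ / 4) (1 / 4)) with hσdef
  have hσ : 0 < σ := lt_min (lt_min (by positivity) (by positivity)) (lt_min (by positivity) (by norm_num))
  have h0 : σ < σ₀ := ((min_le_left _ _).trans (min_le_left _ _)).trans_lt (by linarith)
  have h1 : σ < σ₁ := ((min_le_left _ _).trans (min_le_right _ _)).trans_lt (by linarith)
  have hη : σ ≤ η₀ / 4 := (min_le_right _ _).trans (min_le_left _ _)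
  have h4 : σ ≤ 1 / 4 := (min_le_right _ _).trans (min_le_right _ _)
  have hcube : σ ^ 3 ≤ σ := by
    have := pow_le_pow_of_le_one hσ.le (h4.trans (by norm_num)) (by norm_num : 1 ≤ 3)
    simpa using this
  exact ⟨σ, hσ, h0, h1, by linarith, by linarith⟩

/-- Partial derivatives of constant scalar fields vanish. [folklore] -/
theorem partialDeriv_const_real (i : Fin 3) (c : ℝ) (x : T3) : Torus.partialDeriv i (fun _ : T3 => c) x = 0 := by
  simp [Torus.partialDeriv, Torus.lineDeriv]

/-- Partial derivatives of constant vector fields vanish. [folklore] -/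
theorem partialDeriv_const_V3 (i : Fin 3) (c : V3) (x : T3) : Torus.partialDeriv i (fun _ : T3 => c) x = 0 := by
  simp [Torus.partialDeriv, Torus.lineDeriv]

/-! ## §1 The `t = 0` tie is load-bearing -/

/-- The crux `NearConstantShortTimeHL` with the `t = 0` law-of-large-numbers TIE (the hypothesis
`(∀ χ, Continuous χ → ∀ δ, 0 < δ → [three convergences in probability at time 0]) →`) DELETED; all else verbatim. -/
def NearConstantShortTimeHLUntied : Prop :=
  ∃ η₀ : ℝ, 0 < η₀ ∧ ∀ M : ℝ, 0 < M → ∃ δ₀ : ℝ, 0 < δ₀ ∧ ∃ τ₀ : ℝ, 0 < τ₀ ∧ ∀ (a₀ θ₀ : T3 → ℝ) (u₀ : T3 → V3), Continuous a₀ → Continuous θ₀ → Continuous u₀ → (∀ x, 0 < a₀ x) → (∀ x, 0 < θ₀ x) → ∃ σ₀ : ℝ, 0 < σ₀ ∧ ∀ σ : ℝ, 0 < σ → σ < σ₀ → ∀ (ε : ℕ → ℝ) (n : ℕ → ℕ), (∀ N, 0 < ε N) → Tendsto ε atTop (nhds 0) → Tendsto (fun N => (n N : ℝ) * ε N ^ 3)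 atTop (nhds (σ ^ 3)) → ∀ (T : ℝ) (ρ θ : ℝ → T3 → ℝ) (u : ℝ → T3 → V3), IsHardSphereEulerSolution σ T ρ u θ → (∃ (ubar : V3) (θbar : ℝ), ∀ x, |ρ 0 x - 1| ≤ δ₀ ∧ ‖u 0 x - ubar‖ ≤ δ₀ ∧ |θ 0 x - θbar| ≤ δ₀) → ∀ Φ : (N : ℕ) → HardSphereFlow (Torus.geometry (Fin 3)) (ε N) (n N), let P : (N : ℕ) → Measure (Config (n N) (Fin 3) T3) := fun N => particleLaw (Φ N) (canonicalDensity (Torus.geometry (Fin 3)) (ε N) (n N) (localGibbsProfile a₀ u₀ θ₀)); (∀ N, IsProbabilityMeasure (P N)) → ∀ t ∈ Set.Ico 0 (min T τ₀), (∀ s ∈ Set.Icc 0 t, ∀ x, ρ s x * σ ^ 3 < η₀ ∧ θ s x ≤ M ∧ M⁻¹ ≤ θ s x ∧ ‖u s x‖ ≤ M ∧ ∀ i : Fin 3, |Torus.partialDeriv i (ρ s) x| ≤ M ∧ ‖Torus.partialDeriv i (u s) x‖ ≤ M ∧ |Torus.partialDeriv i (θ s) x| ≤ M) → ∀ χ :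 T3 → ℝ, Continuous χ → ∀ δ : ℝ, 0 < δ → Tendsto (fun N => P N {z | δ < |empiricalDensityField ((Φ N).flow t z) χ - ∫ x, χ x * ρ t x|}) atTop (nhds 0) ∧ Tendsto (fun N => P N {z | δ < ‖empiricalMomentumField ((Φ N).flow t z) χ - ∫ x, (χ x * ρ t x) • u t x‖}) atTop (nhds 0) ∧ Tendsto (fun N => P N {z | δ < |empiricalEnergyField ((Φ N).flow t z) χ - ∫ x, χ x * totalEnergyDensity (ρ t x) (u t x) (θ t x)|}) atTop (nhds 0)

/-- Guards of a constant state `(1, 0, θc)` with `M = 2`, `2⁻¹ ≤ θc ≤ 2`, packing `σ³ < η₀`. [folklore] -/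
theorem guards_const {σ η₀ θc t : ℝ} (hσ3 : σ ^ 3 < η₀) (h1 : θc ≤ 2) (h2 : 2⁻¹ ≤ θc) :
    ∀ s ∈ Icc (0 : ℝ) t, ∀ x : T3,
      (fun (_ : ℝ) (_ : T3) => (1 : ℝ)) s x * σ ^ 3 < η₀ ∧ (fun (_ : ℝ) (_ : T3) => θc) s x ≤ 2 ∧
      (2 : ℝ)⁻¹ ≤ (fun (_ : ℝ) (_ : T3) => θc) s x ∧ ‖(fun (_ : ℝ) (_ : T3) => (0 : V3)) s x‖ ≤ 2 ∧
      ∀ i : Fin 3, |Torus.partialDeriv i ((fun (_ : ℝ) (_ : T3) => (1 : ℝ)) s) x| ≤ 2 ∧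
        ‖Torus.partialDeriv i ((fun (_ : ℝ) (_ : T3) => (0 : V3)) s) x‖ ≤ 2 ∧
        |Torus.partialDeriv i ((fun (_ : ℝ) (_ : T3) => θc) s) x| ≤ 2 := by
  intro s _ x
  refine ⟨by simpa using hσ3, h1, h2, by simp, fun i => ⟨?_, ?_, ?_⟩⟩
  · simp [partialDeriv_const_real]
  · simp [partialDeriv_const_V3]
  · simp [partialDeriv_const_real]

/-- **The tie is load-bearing: `NearConstantShortTimeHLUntied` is FALSE.** Witness: `M = 2`; profiles `(1, 0, 1)`;
`σ` below the offered `σ₀`, below the statics threshold `σ₁` of `lln_rhoLim` (probability of the laws), with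
`2σ³ < η₀` and `σ < 1/2` (Alexander flows); the conjunct's family `(hsDiameter σ N, N+1)`; the two constant classical
solutions `(1,0,1)` and `(1,0,2)` on `[0,1)` (both `δ₀`-near-constant with their own `θbar`, both within all guards);
`t = min(τ₀/2, 1/2)`; `χ ≡ 1`: the energy field would converge in probability to `3/2` and to `3`. [folklore] -/
theorem nearConstantShortTimeHLUntied_false : ¬ NearConstantShortTimeHLUntied := by
  rintro ⟨η₀, hη₀, H⟩
  obtain ⟨δ₀, hδ₀, τ₀, hτ₀, H1⟩ := H 2 two_pos
  obtain ⟨σ₀, hσ₀, H2⟩ := H1 (fun _ => 1) (fun _ => 1) (fun _ => 0) continuous_const continuous_const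
    continuous_const (fun _ => one_pos) (fun _ => one_pos)
  obtain ⟨σ₁, hσ₁, -, L⟩ := lln_rhoLim (a₀ := fun _ : T3 => (1 : ℝ)) (θ₀ := fun _ => (1 : ℝ))
    (u₀ := fun _ => (0 : V3)) continuous_const continuous_const continuous_const (fun _ => one_pos)
    (fun _ => one_pos)
  obtain ⟨σ, hσ, hσ0, hσ1, hση, hσhalf⟩ := exists_small_sigma hσ₀ hσ₁ hη₀
  have hσ3 : σ ^ 3 < η₀ := by nlinarith [pow_pos hσ 3]
  obtain ⟨Φ⟩ := flows_nonempty hσ hσhalf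
  obtain ⟨-, -, hL⟩ := L σ hσ hσ1
  obtain ⟨hprob, -⟩ := hL Φ
  have H3 := H2 σ hσ hσ0 (fun N => hsDiameter σ N) (fun N => N + 1) (fun N => hsDiameter_pos hσ N)
    (tendsto_hsDiameter σ) (tendsto_family_density σ)
  -- the time
  set t : ℝ := min (τ₀ / 2) (1 / 2) with htdef
  have ht0 : 0 < t := lt_min (by positivity) (by norm_num)
  have ht : t ∈ Ico 0 (min 1 τ₀) :=
    ⟨ht0.le, lt_min ((min_le_right _ _).trans_lt (by norm_num)) ((min_le_left _ _).trans_lt (by linarith))⟩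
  -- the two constant solutions
  have hA := H3 1 (fun _ _ => 1) (fun _ _ => 1) (fun _ _ => 0)
    (isHardSphereEulerSolution_const σ 1 (0 : V3) one_pos one_pos)
    ⟨0, 1, fun x => by simp [hδ₀.le]⟩ Φ hprob t ht (guards_const hσ3 (by norm_num) (by norm_num))
    (fun _ => 1) continuous_const
  have hB := H3 1 (fun _ _ => 1) (fun _ _ => 2) (fun _ _ => 0)
    (isHardSphereEulerSolution_const σ 1 (0 : V3) one_pos two_pos)
    ⟨0, 2, fun x => by simp [hδ₀.le]⟩ Φ hprob t ht (guards_const hσ3 le_rfl (by norm_num))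
    (fun _ => 1) continuous_const
  have hab := eq_of_tendsto_measure_lt_abs
    (P := fun N => localGibbsLaw σ (fun _ => 1) (fun _ => 0) (fun _ => 1) N (Φ N))
    (F := fun N z => empiricalEnergyField ((Φ N).flow t z) (fun _ => (1 : ℝ)))
    (Eventually.of_forall hprob) (fun δ hδ => (hA δ hδ).2.2) (fun δ hδ => (hB δ hδ).2.2)
  simp [totalEnergyDensity] at hab
  norm_num at hab

/-! ## §2 The Euler balance laws are load-bearing -/

/-- The crux `NearConstantShortTimeHL` with `IsHardSphereEulerSolution σ T ρ u θ` WEAKENED to its regularity-and-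
positivity part (joint smoothness of `ρ, u, θ` on `[0,T) × 𝕋³`, `ρ, θ > 0`; the three balance laws deleted); the
`t = 0` tie, the near-constancy clause and the guards are kept verbatim. -/
def NearConstantShortTimeHLNoPDE : Prop :=
  ∃ η₀ : ℝ, 0 < η₀ ∧ ∀ M : ℝ, 0 < M → ∃ δ₀ : ℝ, 0 < δ₀ ∧ ∃ τ₀ : ℝ, 0 < τ₀ ∧ ∀ (a₀ θ₀ : T3 → ℝ) (u₀ : T3 → V3), Continuous a₀ → Continuous θ₀ → Continuous u₀ → (∀ x, 0 < a₀ x) → (∀ x, 0 < θ₀ x) → ∃ σ₀ : ℝ, 0 < σ₀ ∧ ∀ σ : ℝ, 0 < σ → σ < σ₀ → ∀ (ε : ℕ → ℝ) (n : ℕ → ℕ), (∀ N, 0 < ε N) → Tendsto ε atTop (nhds 0) → Tendsto (fun N => (n N : ℝ) * ε N ^ 3) atTop (nhds (σ ^ 3)) → ∀ (T : ℝ) (ρ θ : ℝ → T3 → ℝ) (u : ℝ → T3 → V3), Torus.IsSmoothSpaceTimeOn (Set.Ico 0 T) ρ → Torus.IsSmoothSpaceTimeOn (Set.Ico 0 T)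 u → Torus.IsSmoothSpaceTimeOn (Set.Ico 0 T) θ → (∀ t ∈ Set.Ico 0 T, ∀ x, 0 < ρ t x) → (∀ t ∈ Set.Ico 0 T, ∀ x, 0 < θ t x) → (∃ (ubar : V3) (θbar : ℝ), ∀ x, |ρ 0 x - 1| ≤ δ₀ ∧ ‖u 0 x - ubar‖ ≤ δ₀ ∧ |θ 0 x - θbar| ≤ δ₀) → ∀ Φ : (N : ℕ) → HardSphereFlow (Torus.geometry (Fin 3)) (ε N) (n N), let P : (N : ℕ) → Measure (Config (n N) (Fin 3) T3) := fun N => particleLaw (Φ N) (canonicalDensity (Torus.geometry (Fin 3)) (ε N) (n N) (localGibbsProfile a₀ u₀ θ₀)); (∀ N, IsProbabilityMeasure (P N)) → (∀ χ : T3 → ℝ, Continuous χ → ∀ δ : ℝ, 0 < δ → Tendsto (fun N => P N {z | δ < |empiricalDensityField ((Φ N).flow 0 z) χ - ∫ x, χ x * ρ 0 x|}) atTop (nhds 0) ∧ Tendsto (fun N => P N {z | δ < ‖empiricalMomentumField ((Φ N).flow 0 z) χ - ∫ x, (χ x * ρ 0 x) • u 0 x‖}) atTop (nhds 0) ∧ Tendsto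 (fun N => P N {z | δ < |empiricalEnergyField ((Φ N).flow 0 z) χ - ∫ x, χ x * totalEnergyDensity (ρ 0 x) (u 0 x) (θ 0 x)|}) atTop (nhds 0)) → ∀ t ∈ Set.Ico 0 (min T τ₀), (∀ s ∈ Set.Icc 0 t, ∀ x, ρ s x * σ ^ 3 < η₀ ∧ θ s x ≤ M ∧ M⁻¹ ≤ θ s x ∧ ‖u s x‖ ≤ M ∧ ∀ i : Fin 3, |Torus.partialDeriv i (ρ s) x| ≤ M ∧ ‖Torus.partialDeriv i (u s) x‖ ≤ M ∧ |Torus.partialDeriv i (θ s) x| ≤ M) → ∀ χ : T3 → ℝ, Continuous χ → ∀ δ : ℝ, 0 < δ → Tendsto (fun N => P N {z | δ < |empiricalDensityField ((Φ N).flow t z) χ - ∫ x, χ x * ρ t x|}) atTop (nhds 0) ∧ Tendsto (fun N => P N {z | δ < ‖empiricalMomentumField ((Φ N).flow t z) χ - ∫ x, (χ x * ρ t x) • u t x‖}) atTop (nhds 0) ∧ Tendsto (fun N => P N {z | δ < |empiricalEnergyField ((Φ N).flow t z) χ - ∫ x, χ x * totalEnergyDensity (ρ t x) (u t x) (θ t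 x)|}) atTop (nhds 0)

/-- Guards of the ramp state `(1 + s, 0, 1)` with `M = 1` on `[0, t]`, `t ≤ 1/2`, packing `2σ³ < η₀`. [folklore] -/
theorem guards_ramp {σ η₀ t : ℝ} (hση : 2 * σ ^ 3 < η₀) (hσ : 0 < σ) (ht : t ≤ 1 / 2) :
    ∀ s ∈ Icc (0 : ℝ) t, ∀ x : T3,
      ramp s x * σ ^ 3 < η₀ ∧ (fun (_ : ℝ) (_ : T3) => (1 : ℝ)) s x ≤ 1 ∧
      (1 : ℝ)⁻¹ ≤ (fun (_ : ℝ) (_ : T3) => (1 : ℝ)) s x ∧ ‖(fun (_ : ℝ) (_ : T3) => (0 : V3)) s x‖ ≤ 1 ∧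
      ∀ i : Fin 3, |Torus.partialDeriv i (ramp s) x| ≤ 1 ∧
        ‖Torus.partialDeriv i ((fun (_ : ℝ) (_ : T3) => (0 : V3)) s) x‖ ≤ 1 ∧
        |Torus.partialDeriv i ((fun (_ : ℝ) (_ : T3) => (1 : ℝ)) s) x| ≤ 1 := by
  intro s hs x
  have hs1 : 1 + s ≤ 2 := by linarith [hs.2]
  have hσ3 : 0 < σ ^ 3 := pow_pos hσ 3
  refine ⟨?_, le_rfl, by simp, by simp, fun i => ⟨?_, ?_, ?_⟩⟩
  · show (1 + s) * σ ^ 3 < η₀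
    nlinarith
  · show |Torus.partialDeriv i (fun _ : T3 => 1 + s) x| ≤ 1
    simp [partialDeriv_const_real]
  · simp [partialDeriv_const_V3]
  · simp [partialDeriv_const_real]

/-- **The balance laws are load-bearing: `NearConstantShortTimeHLNoPDE` is FALSE.** Witness: `M = 1`; profiles
`(1, 0, 1)`; `σ` below the offered `σ₀` and below the statics threshold `σ₁` of `lln_rhoLim` (pinned density
`rhoLim ≡ 1` for the uniform activity, `rhoLim_uniform_eq_one`), `2σ³ < η₀`, `σ < 1/2`; the conjunct's family; the
smooth positive fields `(1 + t, 0, 1)` on `[0, 1)` — tied at `t = 0`, `δ₀`-near-constant, inside every guard — and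
`t = min(τ₀/2, 1/2)`, `χ ≡ 1`, `δ = t/2`: the empirical density of `1` is identically `1`, the target is `1 + t`, so the
deviation event is the whole space, of probability `1 ↛ 0`. [folklore] -/
theorem nearConstantShortTimeHLNoPDE_false : ¬ NearConstantShortTimeHLNoPDE := by
  rintro ⟨η₀, hη₀, H⟩
  obtain ⟨δ₀, hδ₀, τ₀, hτ₀, H1⟩ := H 1 one_pos
  obtain ⟨σ₀, hσ₀, H2⟩ := H1 (fun _ => 1) (fun _ => 1) (fun _ => 0) continuous_const continuous_const
    continuous_const (fun _ => one_pos) (fun _ => one_pos)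
  obtain ⟨σ₁, hσ₁, -, L⟩ := lln_rhoLim (a₀ := fun _ : T3 => (1 : ℝ)) (θ₀ := fun _ => (1 : ℝ))
    (u₀ := fun _ => (0 : V3)) continuous_const continuous_const continuous_const (fun _ => one_pos)
    (fun _ => one_pos)
  obtain ⟨σ, hσ, hσ0, hσ1, hση, hσhalf⟩ := exists_small_sigma hσ₀ hσ₁ hη₀
  obtain ⟨Φ⟩ := flows_nonempty hσ hσhalf
  obtain ⟨hsd, -, hL⟩ := L σ hσ hσ1
  obtain ⟨hprob, htie⟩ := hL Φ
  have H3 := H2 σ hσ hσ0 (fun N => hsDiameter σ N) (fun N => N + 1) (fun N => hsDiameter_pos hσ N)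
    (tendsto_hsDiameter σ) (tendsto_family_density σ)
  -- the time
  set t : ℝ := min (τ₀ / 2) (1 / 2) with htdef
  have ht0 : 0 < t := lt_min (by positivity) (by norm_num)
  have ht12 : t ≤ 1 / 2 := min_le_right _ _
  have ht : t ∈ Ico 0 (min 1 τ₀) :=
    ⟨ht0.le, lt_min (ht12.trans_lt (by norm_num)) ((min_le_left _ _).trans_lt (by linarith))⟩
  -- the tie for the ramp fields (their time-0 slices are those of `(rhoLim, 0, 1) = (1, 0, 1)`)
  have htie' : TendstoHydroFieldsAt (fun N => localGibbsLaw σ (fun _ => 1) (fun _ => 0) (fun _ => 1) N (Φ N)) Φ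
      ramp (fun _ _ => 0) (fun _ _ => 1) 0 := by
    refine (tendstoHydroFieldsAt_congr_slices (ρ' := fun _ => rhoLim (profileOf (fun _ : T3 => (1 : ℝ))
      continuous_const (fun _ => one_pos)) σ) (u' := fun _ _ => 0) (θ' := fun _ _ => 1) ?_ rfl rfl).2 htie
    rw [ramp_zero, rhoLim_uniform_eq_one hsd]
  have hpos1 : ∀ s ∈ Set.Ico (0 : ℝ) 1, ∀ x : T3, 0 < ramp s x := fun s hs x => by
    simp only [ramp]; linarith [hs.1]
  have hpos2 : ∀ s ∈ Set.Ico (0 : ℝ) 1, ∀ _x : T3, (0 : ℝ) < 1 := fun _ _ _ => one_pos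
  have hnear : ∃ (ubar : V3) (θbar : ℝ), ∀ x : T3, |ramp 0 x - 1| ≤ δ₀ ∧
      ‖(fun (_ : ℝ) (_ : T3) => (0 : V3)) 0 x - ubar‖ ≤ δ₀ ∧ |(fun (_ : ℝ) (_ : T3) => (1 : ℝ)) 0 x - θbar| ≤ δ₀ :=
    ⟨0, 1, fun x => by simp [ramp, hδ₀.le]⟩
  have hC := H3 1 ramp (fun _ _ => 1) (fun _ _ => 0) (isSmoothSpaceTimeOn_ramp _)
    (Torus.isSmoothSpaceTimeOn_of_contDiff contDiff_const _)
    (Torus.isSmoothSpaceTimeOn_of_contDiff contDiff_const _) hpos1 hpos2 hnear Φ hprob htie' t ht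
    (guards_ramp hση hσ ht12) (fun _ => 1) continuous_const (t / 2) (by positivity)
  have h1 := hC.1
  have hmass : ∫ x : T3, (fun _ => (1 : ℝ)) x * ramp t x = 1 + t := by simp [ramp]
  have hset : ∀ N : ℕ, {z : Config (N + 1) (Fin 3) T3 |
      t / 2 < |empiricalDensityField ((Φ N).flow t z) (fun _ => 1) - ∫ x : T3, (fun _ => (1 : ℝ)) x * ramp t x|}
        = univ := by
    intro N
    refine eq_univ_of_forall fun z => ?_
    simp only [mem_setOf_eq, empiricalDensityField_one (Nat.succ_ne_zero N), hmass]
    rw [show (1 : ℝ) - (1 + t) = -t by ring, abs_neg, abs_of_pos ht0]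
    linarith
  simp_rw [hset] at h1
  have h2 : Tendsto (fun N : ℕ => (1 : ℝ≥0∞)) atTop (𝓝 0) := by
    refine h1.congr fun N => ?_
    haveI : IsProbabilityMeasure (particleLaw (Φ N) (canonicalDensity (Torus.geometry (Fin 3)) (hsDiameter σ N)
      (N + 1) (localGibbsProfile (fun _ => 1) (fun _ => 0) fun _ => 1))) := hprob N
    exact measure_univ
  have h3 : (1 : ℝ≥0∞) = 0 :=
    tendsto_nhds_unique (tendsto_const_nhds (x := (1 : ℝ≥0∞)) (f := (atTop : Filter ℕ))) h2
  exact one_ne_zero h3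

/-! ## §3 Hypotheses that are not load-bearing (documentation only) -/

/-- REDUNDANT / COSMETIC HYPOTHESES (information for provers; not landed as lemmas):
* `∀ N, 0 < ε N` and `Tendsto ε atTop (nhds 0)`: `n N * ε N ^ 3 → σ³ > 0` forces `0 < ε N` eventually, and the
  tie at `t = 0` (LLN of the empirical DENSITY towards a continuous profile, for every continuous `χ`) fails along
  any subsequence with `n N` bounded (an `n`-point empirical measure under an absolutely continuous `n`-particle law
  does not concentrate), so `ε N → 0` is implied; both clauses only remove finitely many junk `N`, invisible to
  `Tendsto … atTop`.
* `‖u s x‖ ≤ M`: Galilean covariance on `𝕋³` (`x ↦ x + t·ubar`, test functions `χ(· − t·ubar)`) maps the problem with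
  drift `ubar` to drift `0`; only `‖u − ubar‖` is physical. Harmless (δ₀ may depend on M anyway).
* `∀ N, IsProbabilityMeasure (P N)`: `P N = Z_N⁻¹ 1_D f^{⊗n} dZ` is a probability law iff `0 < Z_N < ∞`, and is the
  ZERO measure otherwise (`0⁻¹ = 0`, Bochner junk `0`), for which hypothesis and conclusion hold trivially; so the
  clause is equivalent to `∀ N, P N ≠ 0` and could be weakened to "eventually" without changing the truth value.
* `θ s x ≤ M`, `M⁻¹ ≤ θ s x`, `|∂ρ|,‖∂u‖,|∂θ| ≤ M`, packing `< η₀`: the C¹ guards make `δ₀(M), τ₀(M)` uniform; none can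
  be dropped by a cheap argument and none is refutable when dropped (each mutation is still implied by the
  conjunct-strength short-time hydrodynamic limit).
[refuter-cdisprove 12502, cycle 1] -/
theorem redundant_hypotheses : True := trivial

/-- A canonical hard-sphere law on `𝕋³` with a nonnegative one-particle profile is either the ZERO measure or a
probability measure: `P = Z⁻¹ 1_D f^{⊗n} dZ` with `0⁻¹ = 0`, and Bochner junk `Z = 0` in the non-integrable case.
[folklore] -/
theorem particleLaw_canonicalDensity_zero_or_prob {ε : ℝ} {n : ℕ}
    (Φ : HardSphereFlow (Torus.geometry (Fin 3)) ε n) {f₀ : T3 × V3 → ℝ} (hf : ∀ y, 0 ≤ f₀ y) :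
    particleLaw Φ (canonicalDensity (Torus.geometry (Fin 3)) ε n f₀) = 0 ∨
      IsProbabilityMeasure (particleLaw Φ (canonicalDensity (Torus.geometry (Fin 3)) ε n f₀)) := by
  set D : Set (Config n (Fin 3) T3) := hardSphereDomain (Torus.geometry (Fin 3)) n ε with hDdef
  have hD : MeasurableSet D := measurableSet_hardSphereDomain _ Torus.measurable_geometry_sepVec n ε
  set g : Config n (Fin 3) T3 → ℝ := D.indicator (tensorPow n f₀) with hgdef
  have hg0 : ∀ z, 0 ≤ g z := fun z =>
    Set.indicator_nonneg (fun w _ => tensorPow_nonneg (fun y => hf y) n w) z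
  set Z : ℝ := canonicalPartition (Torus.geometry (Fin 3)) ε n f₀ with hZdef
  have hZg : Z = ∫ z, g z := rfl
  by_cases hZ : Z = 0
  · left
    rw [particleLaw_eq]
    have h0 : (fun z => ENNReal.ofReal (canonicalDensity (Torus.geometry (Fin 3)) ε n f₀ z)) = 0 := by
      funext z
      simp only [canonicalDensity, Pi.zero_apply]
      rw [← hZdef, hZ, inv_zero, zero_mul, ENNReal.ofReal_zero]
    rw [h0, withDensity_zero]
  · right
    have hint : Integrable g volume := by
      by_contra h
      exact hZ (hZg.trans (integral_undef h))
    have hZpos : 0 < Z := lt_of_le_of_ne (hZg ▸ integral_nonneg hg0) (Ne.symm hZ)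
    refine ⟨?_⟩
    rw [particleLaw_eq, withDensity_apply _ MeasurableSet.univ, Measure.restrict_univ, liouville_eq]
    have h1 : ∀ z, ENNReal.ofReal (canonicalDensity (Torus.geometry (Fin 3)) ε n f₀ z) =
        ENNReal.ofReal Z⁻¹ * ENNReal.ofReal (g z) := by
      intro z
      rw [canonicalDensity, ← hZdef, ENNReal.ofReal_mul (inv_nonneg.2 hZpos.le)]
    simp_rw [← hDdef, h1]
    rw [lintegral_const_mul' _ _ ENNReal.ofReal_ne_top,
      ← ofReal_integral_eq_lintegral_ofReal hint.restrict (ae_of_all _ hg0)]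
    have h2 : ∫ z in D, g z = Z := by
      have e1 : ∫ z in D, g z = ∫ z in D, tensorPow n f₀ z :=
        setIntegral_congr_fun hD fun z hz => by simp only [hgdef, Set.indicator_of_mem hz]
      rw [e1, hZg, hgdef, integral_indicator hD]
    rw [h2, ← ENNReal.ofReal_mul (inv_nonneg.2 hZpos.le), inv_mul_cancel₀ hZ, ENNReal.ofReal_one]

/-- Hence, for the crux's laws (profile `localGibbsProfile a₀ u₀ θ₀ ≥ 0` when `a₀ > 0`), the clause
`IsProbabilityMeasure (P N)` is EQUIVALENT to non-degeneracy `P N ≠ 0`. [folklore] -/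
theorem isProbabilityMeasure_iff_ne_zero {ε : ℝ} {n : ℕ} (Φ : HardSphereFlow (Torus.geometry (Fin 3)) ε n)
    {a₀ θ₀ : T3 → ℝ} {u₀ : T3 → V3} (ha0 : ∀ x, 0 ≤ a₀ x) (hθ0 : ∀ x, 0 ≤ θ₀ x) :
    IsProbabilityMeasure (particleLaw Φ (canonicalDensity (Torus.geometry (Fin 3)) ε n (localGibbsProfile a₀ u₀ θ₀))) ↔
      particleLaw Φ (canonicalDensity (Torus.geometry (Fin 3)) ε n (localGibbsProfile a₀ u₀ θ₀)) ≠ 0 := by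
  have hf : ∀ y : T3 × V3, 0 ≤ localGibbsProfile a₀ u₀ θ₀ y := fun y => by
    have h1 := ha0 y.1
    have h2 : 0 ≤ 2 * Real.pi * θ₀ y.1 := by have := hθ0 y.1; positivity
    unfold localGibbsProfile localMaxwellian
    exact mul_nonneg h1 (mul_nonneg (mul_nonneg zero_le_one (Real.rpow_nonneg h2 _)) (Real.exp_nonneg _))
  constructor
  · intro h h0
    have := h.measure_univ
    rw [h0] at this
    simp at this
  · intro h
    exact (particleLaw_canonicalDensity_zero_or_prob Φ hf).resolve_left h

/-! ## §4 Line `Sketch` (fejer-isometry-window-transfer): stub audit -/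

/-- STUB AUDIT of `Cruxes/NearConstantShortTimeHL/IdeatorTwoSketch.lean` (the PICKED line; the lead's reshaped
`Lines/Sketch.lean` was not yet published in the crux directory at this cycle):
* `IsometryAverageLe` — TRUE (its two halves `norm_average_mul_window_le`, `norm_average_window_le` are proved in the
  sketch; the stated form with `2S‖x‖/T` follows with `k = ⌊T/S⌋`, `T − kS < S`).
* `FejerCesaroComparison` — TRUE, even with constant `1` in place of `2`: for isometries with the group law
  `‖∫₀^S U s x‖² = 2∫₀^S (S−u) c(u) du = 2∫₀^S C(u) du`, `C(u) = ∫₀ᵘ c`, `|c| ≤ ‖x‖²`; split at `S₀`: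
  `(2/S²)∫₀^{S₀} C ≤ (S₀/S)²‖x‖²`, `(2/S²)∫_{S₀}^S u·(u⁻¹C(u)) du ≤ sup_{[S₀,S]} |u⁻¹ C(u)|`. The `⨆` over `Set.Icc S₀ S`
  is a genuine supremum (nonempty, bounded by `‖x‖²`). No small-model refutation.
* `SemigroupRigidity` — TRUE: `‖S t − 1 − tΩ‖ ≤ Ct²` gives the right derivative `S'(t⁺) = S(t)Ω` on `[0,∞)` from the
  semigroup law, continuous in `t`, so `S` solves the linear ODE `S' = SΩ`, `S 0 = 1`, whose unique solution is
  `exp(tΩ)` (Grönwall on `‖S t − exp(tΩ)‖`). (The hypothesis `Continuous S` on all of `ℝ` is stronger than needed.)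
* `EulerWindowKineticNoLeak`, `ExpWindowDecay` — open-problem content (equilibrium time-correlation decay of fast
  one-body fields for deterministic dilute hard spheres, `N → ∞` at fixed `σ`). OBLIGATION (hygiene, for the lead):
  both integrate `s ↦ fastField χ h ((Φ N).flow s z)`; `HardSphereFlow` records measurability of each `Φ_t` but NOT
  joint measurability of `(s, z) ↦ Φ_s z`, which is what makes `z ↦ ∫ s in 0..S, …` AE-strongly-measurable and the
  OUTER Bochner integral non-junk (were it junk `0`, `EulerWindowKineticNoLeak` would read `(N+1)·0 → 0` and
  `ExpWindowDecay` `log 0 = 0 ≤ δγ²`, both vacuous). Joint measurability on `[0,S] × good` IS derivable (positions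
  continuous, velocities right-continuous in `s` ⇒ dyadic right-endpoint approximants converge pointwise; `good` is
  conull and the Gibbs law is `≪` Liouville), so the stubs are genuine — but this should be a named lemma of the line
  before any stub is priced or consumed.
* `BridgeShape : ExpWindowDecay → NearConstantShortTimeHL` — hides (i) the energy-current class: `ExpWindowDecay` is
  typed for BOUNDED fast `h` (`|h| ≤ 1`) while the heat current is cubic; the exponential-moment currency is false for
  cubic `h` (crux 9282: `Theorems/KineticWindowGronwall/Negative/CubicMomentDiverges.lean`), so the bridge must pass
  through a truncation + Gaussian-shell-moment argument that is not in the antecedent; (ii) general `(ε_N, n_N)`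
  families vs the antecedent's conjunct family `(hsDiameter σ N, N+1)` ("by reindexing" is not a proof: `n ε³ → σ³`
  is not `= σ³`, so σ-continuity of every static input is consumed); (iii) drift `ubar ≠ 0` vs the antecedent's
  `u₀ = 0` Gibbs law (Galilean covariance of `fastField` requires `h(· − ubar)` to stay in the bounded fast class —
  true). None of (i)–(iii) is refutable here (each is conjecture-strength or true).
[refuter-cdisprove 12502, cycle 1] -/
theorem line_sketch_audit : True := trivial

/-- CARD-LEMMA AUDIT of `Cruxes/NearConstantShortTimeHL/Ideator1Sketch.lean` (ideator 1's three cards; the payload's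
`line.skeleton_path …074554Z-Sketch.lean` carries this file's timestamp, PICKED.md names ideator 2's — both audited):
* `MeansPinLLN` (card means-pin-entropy: convergence of the time-`t` EXPECTATIONS of the three fields ⇒ the LLN at
  `t`, pre-shock, dilute band) — TRUE IN SUBSTANCE and the right transfer: `log` of a canonical local Gibbs density is
  LINEAR in the empirical conserved one-body sums, so Liouville invariance of `∫ f log f` gives the exact identity
  `H(f_t | ψ_λ)/n = [E₀⟨λ₀,Ū⟩ − P_n(λ₀)] − [E_t⟨λ,Ū⟩ − P_n(λ)]`; with `λ = λ(U^E_t)`, static pressure convergence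
  (tree statics, dilute) and ISENTROPY of classical solutions (needs `C¹` thermodynamic consistency of
  `p = ρθZ(ρσ³)`, i.e. differentiability of `hsExcessFreeEnergy` on the band — tree: analytic EOS at low density) the
  bracket difference is `∫ρs(t) − ∫ρs(0) = 0`, so `H = o(n)` and static LD under `ψ^E_t` gives the LLN. Caveats for
  the prover: (a) `E_t⟨λ,Ū⟩ → ⟨λ,U^E_t⟩` needs the ENERGY expectation (quadratic `v`-growth; hypothesis C⁺ supplies
  it); (b) `P_n(λ) → P(λ)` must hold for `x`-dependent `λ` with `θ`-component `−1/θ(t,x)` (local pressure functional,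
  dilute band only — hence the packing guard is load-bearing here). Not refutable; keep.
* `SmallTiltDomination` (static) — TRUE: activity ratio `a₀/(ā e^δ) ≤ 1`; Maxwellian ratio
  `M_{θ₀,u₀}/M_{θ̄(1+2δ),ū} ≤ ((1+2δ)/(1−δ))^{3/2} exp(δ/(2θ̄)) = e^{O_M(δ)}` per particle since `θ̄(1+2δ) − θ₀ ≥ δθ̄` and
  `‖u₀−ū‖ ≤ δ`; partition functions depend on the activity only (`∫ M dv = 1`, `localMaxwellian` is normalised) and
  `Z(a₀) ≥ e^{−δn} Z(ā)`, `Z(ā e^δ) = e^{δn} Z(ā)`; junk cases (`Z = 0`, `n = 0`) give `0 ≤ 0` / `1 ≤ 1`. Not refutable.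
* `TiltRadius` (card tilt-radius) — MISSTATED (physically false as typed, not Lean-refutable): it asserts an
  `N`-UNIFORM analyticity radius `r₀(M)` in the tilt AMPLITUDE `d` of the time-`t` one-body means for ALL `t ≤ 1` and
  ALL continuous tilt SHAPES of sup-norm `≤ 1` ("never the shape or its gradients"). Take `ā = θ̄ = 1`, `ū = 0`,
  `ϑ = w = 0`, `α(x) = cos(2πk x₁)`, `wObs = χ(x)` a trigonometric polynomial, `t = 1`: the tilted datum is a sound
  wave of amplitude `d`, wavelength `1/k`, which shocks at `t_*(d) ≍ 1/(C d k)`, i.e. at `t = 1` for every real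
  `d > d_* ≍ 1/(Ck)`; choose `k ≫ 1/r₀(M)` so `d_* ≪ r₀`. By Montel/Vitali, `N`-uniformly bounded holomorphic `g_N` on
  `B(0,r₀)` that converge on real `d` force the limit of the means to be REAL-ANALYTIC on `(−r₀, r₀)`; but for
  `d < d_*` the limit is the classical-Euler moment, whose analytic continuation past `d_*` is the multivalued
  (characteristics) moment, while for `d > d_*` the gas follows the entropy solution, whose local density moments
  differ from the multivalued ones — a kink at `d_*` inside the disc. So `r₀` cannot be uniform in the shape's
  Lipschitz constant `L` at fixed `t`. REPAIR (what the crux actually needs): analyticity on `|d| < r₀(M)/(1 + L·t)`,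
  `L = Lip(α,ϑ,w)`, or equivalently `r₀(M)` for `t ≤ τ(M)/(1+L)`; this matches the crux, whose guards `|∂ρ| ≤ M`,
  amplitude `≤ δ₀(M)` and `t < τ₀(M) ≲ 1/(CM)` keep every guarded datum pre-shock with amplitude inside the corrected
  radius `δ₀/(C M t) ≥ δ₀`. Filed as `stub-misstated: TiltRadius` on the crux item.
* `EquilibriumClosureTightness` — open (crux-strength LD input: an `O(1)` momentum-closure defect under the invariant
  drifted Gibbs law costs `e^{−c₀ n}` uniformly in the defect size). Plausible at fixed density (sustaining a
  non-Maxwellian stress over a macroscopic window costs entropy production `≍ n·N^{1/3}`, superexponential; vacuum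
  bubbles / hot or cold spots of cost `e^{−O(n)}` refill or thermalise hydrodynamically because the mean free path in
  any region of positive density is `≍ N^{-1/3}`); no cheap counter-scenario found. Not refutable.
[refuter-cdisprove 12502, cycle 1] -/
theorem ideator_one_audit : True := trivial

/-! ## §5 Why the crux resists -/

/-- WHY IT RESISTS. A refutation of `NearConstantShortTimeHL` must exhibit profiles, a family, flows and a classical
solution meeting the tie + near-constancy + guards, and a time `t < τ₀` at which one empirical field provably does
NOT converge to the Euler value. The time-`t` law of `N → ∞` deterministic hard spheres is computable only through
(a) exact conservation laws (`χ ≡ 1`: mass, momentum, energy — all consistent with every Euler solution),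
(b) invariant laws: the homogeneous Gibbs laws `localGibbsLaw σ a ubar θ` are invariant under every `HardSphereFlow`
(Liouville + energy/momentum conservation; tree `measurePreserving_flow_localGibbsLaw_const`), giving constant data
`(1, ubar, θ)`, for which the constant state is a classical solution and — in the dilute class, by the tree's
analytic-EOS uniqueness `unique_of_dilute` — the ONLY one, so the conclusion HOLDS; (c) covariances (Galilean boosts,
velocity scaling, reflections, time reversal), which map instances to instances. Hence no rigorous counterexample is
available without new mathematics: either an `O(1)`-slow non-hydrodynamic mode of the dilute hard-sphere gas at fixed
`σ` (contradicting the kinetic picture: non-conserved one-body modes relax in `≍ N^{-1/3}` macroscopic time; no such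
mode is known, cf. Spohn 1991 §7.1, Dorfman–van Beijeren–Kirkpatrick 2021 Ch. 4–6 on long-time tails, which are
`t^{-3/2}` CORRECTIONS vanishing at Euler scaling), or a second classical hs-Euler solution from near-constant dilute
data (excluded). Small/finite models are unavailable: every hypothesis is asymptotic in `N` and the flows are genuine
billiards. Degenerate regimes (`M < 1` makes the θ-guard `M⁻¹ ≤ θ ≤ M` unsatisfiable ⇒ vacuous; `T ≤ 0` ⇒ vacuous;
`t = 0` ⇒ conclusion = tie) are all vacuous-true, never false. VERDICT (cycle 1): survives; difficulty label
"open-problem" is honest; the two landed negatives (§1, §2) only certify that the tie and the balance laws are used.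
[refuter-cdisprove 12502, cycle 1] -/
theorem why_it_resists : True := trivial

end Summit.AtomisticToContinuum.HydrodynamicLimit.Cruxes.NearConstantShortTimeHL.Disproof

end
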